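import Summits.ValiantsHypothesis.ValiantsHypothesis.Theorems.EquivariantDialCornerDescent
import Summits.ValiantsHypothesis.ValiantsHypothesis.Theorems.EquivariantDialFiniteSupplement
import HarnessLib

/-!
# Local shrinking: `LocalShrinking` and cell A (`EqHardBiPerm`) as theorems
(support of `CollapseToVPws`, stmt-ValiantsHypothesis-23702; road to `LocalShrinking`, part 3/3)

Honest scope.  This file is NOT a route and closes NO item.  VP ≠ VNP is NOT proved here and
nothing below is progress on it; 0 S-currency.  Cell A (`EquivariantDialNode.EqHardBiPerm`)
becomes a THEOREM here (`eqHardBiPerm`), but it is a SUPPORT statement of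
stmt-ValiantsHypothesis-23702 only: 23702 (`CollapseToVPws`), `DcPerSuperpolynomial` and
VP ≠ VNP are UNTOUCHED.

## Contents (the exchange step)

* `lifts_of_block` — gauge lifts `A(γ·x) = C(P) A C(Q)` of `A` transported to a block form
  `C(U) A C(V) = B` (reindexed): `B(γ·x) C(H) = C(G) B` with `G, H` invertible.
* `corner_lift` — **exchange.** If `B = P ⊕ Q` with `IsLocalRepr P`, `det P = f` prime and
  `det Q` a nonzero constant, then every such lift of `B` restricts to a lift of the corner:
  `P(γ·x) = C(g) P C(h)`.  With `a = (G'₁₁G₁₁, H'₁₁H₁₁)` and `b = (G'₁₂G₂₁, H'₁₂H₂₁)`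
  (`G' = G⁻¹, H' = H⁻¹`) one has `a, b ∈ pairAlg P` and `a + b = 1`; locality makes `a` a unit
  (then `G₁₁, H₁₁` are invertible and conjugate `P(γ·x)` to `P`) unless `a` is nilpotent, in
  which case `b` is a unit — impossible: reducing modulo `f`, a kernel vector of `P mod f`
  is killed by the invertible constant matrix `H'₁₂H₂₁` because `det Q(γ·x) mod f ≠ 0`.
* `localShrinking : LocalShrinking` — corner descent (part 2/3, with `f = per_m`, prime by
  `perPoly_irreducible`) followed by the exchange; `m = 0` is the empty matrix.
* `eqHardBiPerm : EqHardBiPerm` — by `eqHardBiPerm_of_localShrinking`.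

Classical mathematics (Krull–Schmidt / Fitting exchange for matrix pencils); no Literature fact
is used as a hypothesis.

Labels (critic K5, CALL 2298).  Restricted-model lower bound (necessity side), inside the
equivariance barrier; 0 S-currency; closes NO item; `DcPerSuperpolynomial` / VP ≠ VNP untouched.
Cell A PROVED; piece L ⟺ (A → W) is henceforth EQUIVALENT to W — the W36 dial is exhausted
(LESSON 6 terminal state).  Print status: Landsberg–Ressayre 2017 prove their bounds for
representations respecting `N(T^{GL(E)})` (Thm 2.8, left permutation AND diagonal matrices,
`n ≥ 2^m - 1`) or all of `G_{per_m}` (Thm 2.1), and their proof outline (§3.6: "The first step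
consists in lifting `G` to `G_A` … a reductive subgroup `G̃` of `G_A` such that `ρ̄_A : G̃ → G` is
finite and surjective … using Malcev's theorem") then runs on torus weights; the
permutation-only group `𝔖_m × 𝔖_m` with exact lifts (no torus) is not treated there, so by my
search the statement `eqHardBiPerm` (superpolynomial, no explicit exponential constant) is not
in print in this form and answers the finite-group case `𝔖_m × 𝔖_m` of the parenthetical
question of Landsberg 2017, p. 194, in kernel.  Non-vacuity (K6): the model is inhabited at
`m = 2` by `per_2 = det [[x₁₁, -x₁₂], [x₂₁, x₂₂]]`, `𝔖_2 × 𝔖_2`-equivariant with exact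
signed-permutation lifts (row swap = swap the rows and negate column 2; column swap = swap the
columns and negate row 1); at `m = 0` both sides are the empty matrix.
[cite: LandsbergRessayre2017, Def. 1.3, Thm 2.8, §3.6]; [cite: Vonzurgathen1987].
-/

set_option linter.dupNamespace false

namespace Summit.ValiantsHypothesis.ValiantsHypothesis.Theorems.EquivariantDialLocalShrinking

noncomputable section

open MvPolynomial Matrix
open Literature.Computability.AlgebraicComplexity
open Summit.ValiantsHypothesis.ValiantsHypothesis.Theorems.EquivariantDialNode
open Summit.ValiantsHypothesis.ValiantsHypothesis.Theorems.EquivariantDialPairAlgebra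
open Summit.ValiantsHypothesis.ValiantsHypothesis.Theorems.EquivariantDialCornerDescent
open Summit.ValiantsHypothesis.ValiantsHypothesis.Theorems.EquivariantDialFiniteSupplement

variable {k : Type*} [Field k] {σ : Type*} [Fintype σ] [DecidableEq σ]

/-- Gauge lifts transported to a (reindexed) block form `C(U) A C(V) = B`:
`B(γ·x) · C(H) = C(G) · B` with `G, H` invertible. -/
theorem lifts_of_block {Γ : Subgroup (GL σ k)} {s : ℕ} {m : Type*} [Fintype m] [DecidableEq m]
    {A : Matrix (Fin s) (Fin s) (MvPolynomial σ k)}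
    (hA : ∀ γ ∈ Γ, ∃ P Q : GL (Fin s) k, Matrix.linSubstEntries γ A =
      (P : Matrix (Fin s) (Fin s) k).map C * A * (Q : Matrix (Fin s) (Fin s) k).map C)
    (U V : GL (Fin s) k) (e : m ≃ Fin s) {B : Matrix m m (MvPolynomial σ k)}
    (hB : (U : Matrix (Fin s) (Fin s) k).map C * A * (V : Matrix (Fin s) (Fin s) k).map C =
      Matrix.reindex e e B) :
    ∀ γ ∈ Γ, ∃ G H : GL m k,
      Matrix.linSubstEntries γ B * (H : Matrix m m k).map C = (G : Matrix m m k).map C * B := by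
  intro γ hγ
  obtain ⟨P, Q, hPQ⟩ := forall_exists_lift_mul_mul hA U V γ hγ
  rw [hB] at hPQ
  have hsub : ∀ X : Matrix m m (MvPolynomial σ k), (Matrix.reindex e e X).submatrix e e = X :=
    fun X => by simp [Matrix.reindex_apply, Matrix.submatrix_submatrix]
  have hBγ : Matrix.linSubstEntries γ B =
      ((P : Matrix (Fin s) (Fin s) k).submatrix e e).map C * B *
        ((Q : Matrix (Fin s) (Fin s) k).submatrix e e).map C := by
    have h := congrArg (fun X : Matrix (Fin s) (Fin s) (MvPolynomial σ k) => X.submatrix e e) hPQ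
    simp only [Matrix.linSubstEntries] at h ⊢
    rw [← Matrix.submatrix_mul_equiv ((P : Matrix (Fin s) (Fin s) k).map C * Matrix.reindex e e B)
        ((Q : Matrix (Fin s) (Fin s) k).map C) e e e,
      ← Matrix.submatrix_mul_equiv ((P : Matrix (Fin s) (Fin s) k).map C) (Matrix.reindex e e B)
        e e e] at h
    simp only [Matrix.submatrix_map, hsub] at h
    exact h
  have hPdet : IsUnit ((P : Matrix (Fin s) (Fin s) k).submatrix e e).det := by
    rw [Matrix.det_submatrix_equiv_self]
    exact Matrix.isUnits_det_units P
  have hQdet : IsUnit ((Q : Matrix (Fin s) (Fin s) k).submatrix e e).det := by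
    rw [Matrix.det_submatrix_equiv_self]
    exact Matrix.isUnits_det_units Q
  refine ⟨((Matrix.isUnit_iff_isUnit_det _).mpr hPdet).unit,
    (((Matrix.isUnit_iff_isUnit_det _).mpr hQdet).unit)⁻¹, ?_⟩
  rw [Matrix.coe_units_inv, IsUnit.unit_spec, IsUnit.unit_spec, hBγ, Matrix.mul_assoc,
    ← Matrix.map_mul, Matrix.mul_nonsing_inv _ hQdet, Matrix.map_one C C_0 C_1, Matrix.mul_one]

/-- **Exchange.** For `B = P ⊕ Q` with `IsLocalRepr P`, `det P = f` prime and `det Q = C c`,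
`c ≠ 0`, every lift `B(γ·x) C(H) = C(G) B` (`G, H` invertible) restricts to the corner:
`P(γ·x) = C(g) P C(h)` with `g, h` invertible.  ★ Labels: restricted-model lower bound, inside
the equivariance barrier; 0 S-currency; closes NO item; `DcPerSuperpolynomial` / VP ≠ VNP
untouched. -/
theorem corner_lift {r : ℕ} {ι : Type*} [Fintype ι] [DecidableEq ι] {f : MvPolynomial σ k}
    (hf : Prime f) {P : Matrix (Fin r) (Fin r) (MvPolynomial σ k)}
    {Q : Matrix ι ι (MvPolynomial σ k)} (hloc : IsLocalRepr P) (hP : P.det = f) {cQ : k}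
    (hcQ : cQ ≠ 0) (hQ : Q.det = C cQ) (γ : GL σ k) (G H : GL (Fin r ⊕ ι) k)
    (hlift : Matrix.linSubstEntries γ (fromBlocks P 0 0 Q) *
        (H : Matrix (Fin r ⊕ ι) (Fin r ⊕ ι) k).map C =
      (G : Matrix (Fin r ⊕ ι) (Fin r ⊕ ι) k).map C * fromBlocks P 0 0 Q) :
    ∃ g h : GL (Fin r) k, Matrix.linSubstEntries γ P =
      (g : Matrix (Fin r) (Fin r) k).map C * P * (h : Matrix (Fin r) (Fin r) k).map C := by
  -- the substituted block matrix
  have hBγ : Matrix.linSubstEntries γ (fromBlocks P 0 0 Q) =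
      fromBlocks (Matrix.linSubstEntries γ P) 0 0 (Matrix.linSubstEntries γ Q) := by
    simp only [Matrix.linSubstEntries, Matrix.fromBlocks_map, Matrix.map_zero, map_zero]
  -- the companion identity `C(G⁻¹) B(γ·x) = B C(H⁻¹)`
  have hHH' : ((H : Matrix (Fin r ⊕ ι) (Fin r ⊕ ι) k).map C : Matrix _ _ (MvPolynomial σ k)) *
      ((H⁻¹ : GL (Fin r ⊕ ι) k) : Matrix (Fin r ⊕ ι) (Fin r ⊕ ι) k).map C = 1 := by
    rw [← Matrix.map_mul, ← Units.val_mul, mul_inv_cancel, Units.val_one, Matrix.map_one C C_0 C_1]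
  have hlift' : ((G⁻¹ : GL (Fin r ⊕ ι) k) : Matrix (Fin r ⊕ ι) (Fin r ⊕ ι) k).map C *
        Matrix.linSubstEntries γ (fromBlocks P 0 0 Q) =
      fromBlocks P 0 0 Q * ((H⁻¹ : GL (Fin r ⊕ ι) k) : Matrix (Fin r ⊕ ι) (Fin r ⊕ ι) k).map C :=
    calc ((G⁻¹ : GL (Fin r ⊕ ι) k) : Matrix (Fin r ⊕ ι) (Fin r ⊕ ι) k).map C *
          Matrix.linSubstEntries γ (fromBlocks P 0 0 Q)
        = ((G⁻¹ : GL (Fin r ⊕ ι) k) : Matrix (Fin r ⊕ ι) (Fin r ⊕ ι) k).map C *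
            (Matrix.linSubstEntries γ (fromBlocks P 0 0 Q) *
              (H : Matrix (Fin r ⊕ ι) (Fin r ⊕ ι) k).map C) *
            ((H⁻¹ : GL (Fin r ⊕ ι) k) : Matrix (Fin r ⊕ ι) (Fin r ⊕ ι) k).map C := by
          rw [Matrix.mul_assoc, Matrix.mul_assoc, hHH', Matrix.mul_one]
      _ = fromBlocks P 0 0 Q *
            ((H⁻¹ : GL (Fin r ⊕ ι) k) : Matrix (Fin r ⊕ ι) (Fin r ⊕ ι) k).map C := by
          rw [hlift, inv_map_C_mul_cancel_left]
  -- blocks of `G, H, G⁻¹, H⁻¹`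
  obtain ⟨G₁₁, G₁₂, G₂₁, G₂₂, hG⟩ : ∃ (X₁₁ : Matrix (Fin r) (Fin r) k) (X₁₂ : Matrix (Fin r) ι k)
      (X₂₁ : Matrix ι (Fin r) k) (X₂₂ : Matrix ι ι k),
      (G : Matrix (Fin r ⊕ ι) (Fin r ⊕ ι) k) = fromBlocks X₁₁ X₁₂ X₂₁ X₂₂ :=
    ⟨_, _, _, _, (Matrix.fromBlocks_toBlocks _).symm⟩
  obtain ⟨H₁₁, H₁₂, H₂₁, H₂₂, hH⟩ : ∃ (X₁₁ : Matrix (Fin r) (Fin r) k) (X₁₂ : Matrix (Fin r) ι k)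
      (X₂₁ : Matrix ι (Fin r) k) (X₂₂ : Matrix ι ι k),
      (H : Matrix (Fin r ⊕ ι) (Fin r ⊕ ι) k) = fromBlocks X₁₁ X₁₂ X₂₁ X₂₂ :=
    ⟨_, _, _, _, (Matrix.fromBlocks_toBlocks _).symm⟩
  obtain ⟨G'₁₁, G'₁₂, G'₂₁, G'₂₂, hG'⟩ : ∃ (X₁₁ : Matrix (Fin r) (Fin r) k)
      (X₁₂ : Matrix (Fin r) ι k) (X₂₁ : Matrix ι (Fin r) k) (X₂₂ : Matrix ι ι k),
      ((G⁻¹ : GL (Fin r ⊕ ι) k) : Matrix (Fin r ⊕ ι) (Fin r ⊕ ι) k) = fromBlocks X₁₁ X₁₂ X₂₁ X₂₂ :=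
    ⟨_, _, _, _, (Matrix.fromBlocks_toBlocks _).symm⟩
  obtain ⟨H'₁₁, H'₁₂, H'₂₁, H'₂₂, hH'⟩ : ∃ (X₁₁ : Matrix (Fin r) (Fin r) k)
      (X₁₂ : Matrix (Fin r) ι k) (X₂₁ : Matrix ι (Fin r) k) (X₂₂ : Matrix ι ι k),
      ((H⁻¹ : GL (Fin r ⊕ ι) k) : Matrix (Fin r ⊕ ι) (Fin r ⊕ ι) k) = fromBlocks X₁₁ X₁₂ X₂₁ X₂₂ :=
    ⟨_, _, _, _, (Matrix.fromBlocks_toBlocks _).symm⟩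
  -- `G⁻¹ G = 1` and `H⁻¹ H = 1`, upper-left blocks
  have hGG : G'₁₁ * G₁₁ + G'₁₂ * G₂₁ = 1 := by
    have h : ((G⁻¹ : GL (Fin r ⊕ ι) k) : Matrix (Fin r ⊕ ι) (Fin r ⊕ ι) k) *
        (G : Matrix (Fin r ⊕ ι) (Fin r ⊕ ι) k) = 1 := by
      rw [← Units.val_mul, inv_mul_cancel, Units.val_one]
    rw [hG', hG, Matrix.fromBlocks_multiply, ← Matrix.fromBlocks_one] at h
    exact (Matrix.fromBlocks_inj.mp h).1
  have hHH : H'₁₁ * H₁₁ + H'₁₂ * H₂₁ = 1 := by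
    have h : ((H⁻¹ : GL (Fin r ⊕ ι) k) : Matrix (Fin r ⊕ ι) (Fin r ⊕ ι) k) *
        (H : Matrix (Fin r ⊕ ι) (Fin r ⊕ ι) k) = 1 := by
      rw [← Units.val_mul, inv_mul_cancel, Units.val_one]
    rw [hH', hH, Matrix.fromBlocks_multiply, ← Matrix.fromBlocks_one] at h
    exact (Matrix.fromBlocks_inj.mp h).1
  -- the block identities
  have hmain := hlift
  rw [hBγ, hH, hG, Matrix.fromBlocks_map, Matrix.fromBlocks_map, Matrix.fromBlocks_multiply,
    Matrix.fromBlocks_multiply] at hmain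
  simp only [Matrix.zero_mul, Matrix.mul_zero, add_zero, zero_add] at hmain
  obtain ⟨h11, -, h21, -⟩ := Matrix.fromBlocks_inj.mp hmain
  rw [hBγ, hG', hH', Matrix.fromBlocks_map, Matrix.fromBlocks_map, Matrix.fromBlocks_multiply,
    Matrix.fromBlocks_multiply] at hlift'
  simp only [Matrix.zero_mul, Matrix.mul_zero, add_zero, zero_add] at hlift'
  obtain ⟨h11', h12', -, -⟩ := Matrix.fromBlocks_inj.mp hlift'
  -- two complementary elements of the pair algebra of `P`
  have ha : ((G'₁₁ * G₁₁, H'₁₁ * H₁₁) : Matrix (Fin r) (Fin r) k × Matrix (Fin r) (Fin r) k) ∈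
      pairAlg P := by
    rw [mem_pairAlg]
    dsimp only
    rw [Matrix.map_mul, Matrix.map_mul, Matrix.mul_assoc, ← h11,
      ← Matrix.mul_assoc _ (Matrix.linSubstEntries γ P) _, h11', Matrix.mul_assoc]
  have hb : ((G'₁₂ * G₂₁, H'₁₂ * H₂₁) : Matrix (Fin r) (Fin r) k × Matrix (Fin r) (Fin r) k) ∈
      pairAlg P := by
    rw [mem_pairAlg]
    dsimp only
    rw [Matrix.map_mul, Matrix.map_mul, Matrix.mul_assoc, ← h21,
      ← Matrix.mul_assoc _ (Matrix.linSubstEntries γ Q) _, h12', Matrix.mul_assoc]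
  have hab : ((G'₁₁ * G₁₁, H'₁₁ * H₁₁) : Matrix (Fin r) (Fin r) k × Matrix (Fin r) (Fin r) k) +
      (G'₁₂ * G₂₁, H'₁₂ * H₂₁) = 1 := by
    rw [Prod.mk_add_mk, hGG, hHH]
    rfl
  obtain ⟨μ, hμ⟩ := hloc _ ha
  by_cases hμ0 : μ = 0
  · -- `a` nilpotent, so `b = 1 - a` is a unit: contradiction modulo `f`
    exfalso
    rw [hμ0, map_zero, sub_zero] at hμ
    have hbu : IsUnit (((G'₁₂ * G₂₁, H'₁₂ * H₂₁) :
        Matrix (Fin r) (Fin r) k × Matrix (Fin r) (Fin r) k)) := by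
      have h := hμ.isUnit_one_sub
      rwa [← hab, add_sub_cancel_left] at h
    have hb2 : IsUnit (H'₁₂ * H₂₁) := (Prod.isUnit_iff.mp hbu).2
    have hu₂det : IsUnit (H'₁₂ * H₂₁).det := (Matrix.isUnit_iff_isUnit_det _).mp hb2
    -- reduction modulo `f`
    haveI hI : (Ideal.span ({f} : Set (MvPolynomial σ k))).IsPrime :=
      (Ideal.span_singleton_prime hf.ne_zero).mpr hf
    obtain ⟨π, hπf, hπC⟩ : ∃ π : MvPolynomial σ k →+* MvPolynomial σ k ⧸ Ideal.span {f},
        π f = 0 ∧ ∀ c : k, c ≠ 0 → π (C c) ≠ 0 := by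
      refine ⟨Ideal.Quotient.mk _,
        Ideal.Quotient.eq_zero_iff_mem.mpr (Ideal.mem_span_singleton_self f), fun c hc h => ?_⟩
      rw [Ideal.Quotient.eq_zero_iff_mem, Ideal.mem_span_singleton] at h
      exact hf.not_unit (isUnit_of_dvd_unit h ((IsUnit.mk0 c hc).map C))
    obtain ⟨v, hv0, hPv⟩ := Matrix.exists_mulVec_eq_zero_iff.mpr
      (show (P.map π).det = 0 by rw [← RingHom.mapMatrix_apply, ← RingHom.map_det, hP, hπf])
    have h21π : (Matrix.linSubstEntries γ Q).map π *
        ((H₂₁.map C : Matrix ι (Fin r) (MvPolynomial σ k)).map π) =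
        ((G₂₁.map C : Matrix ι (Fin r) (MvPolynomial σ k)).map π) * P.map π := by
      rw [← Matrix.map_mul, ← Matrix.map_mul, h21]
    have hQv : (Matrix.linSubstEntries γ Q).map π *ᵥ
        (((H₂₁.map C : Matrix ι (Fin r) (MvPolynomial σ k)).map π) *ᵥ v) = 0 := by
      rw [Matrix.mulVec_mulVec, h21π, ← Matrix.mulVec_mulVec, hPv, Matrix.mulVec_zero]
    have hQdet : ((Matrix.linSubstEntries γ Q).map π).det ≠ 0 := by
      rw [← RingHom.mapMatrix_apply, ← RingHom.map_det, det_linSubstEntries, hQ, linSubst_C]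
      exact hπC cQ hcQ
    have hHv : ((H₂₁.map C : Matrix ι (Fin r) (MvPolynomial σ k)).map π) *ᵥ v = 0 :=
      Matrix.eq_zero_of_mulVec_eq_zero hQdet hQv
    have hu₂π :
        (((H'₁₂ * H₂₁).map C : Matrix (Fin r) (Fin r) (MvPolynomial σ k)).map π).det ≠ 0 := by
      rw [Matrix.map_map, ← RingHom.coe_comp, ← RingHom.mapMatrix_apply, ← RingHom.map_det,
        RingHom.comp_apply]
      exact hπC _ hu₂det.ne_zero
    exact hv0 (Matrix.eq_zero_of_mulVec_eq_zero hu₂π (by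
      rw [Matrix.map_mul, Matrix.map_mul, ← Matrix.mulVec_mulVec, hHv, Matrix.mulVec_zero]))
  · -- `a = μ + nilpotent` with `μ ≠ 0`, so `a` is a unit and `G₁₁, H₁₁` are invertible
    have hau : IsUnit (((G'₁₁ * G₁₁, H'₁₁ * H₁₁) :
        Matrix (Fin r) (Fin r) k × Matrix (Fin r) (Fin r) k)) := by
      have h := hμ.isUnit_add_right_of_commute ((IsUnit.mk0 μ hμ0).map
        (algebraMap k (Matrix (Fin r) (Fin r) k × Matrix (Fin r) (Fin r) k)))
        (Algebra.commute_algebraMap_right μ _)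
      rwa [sub_add_cancel] at h
    have ha1 : IsUnit (G'₁₁ * G₁₁) := (Prod.isUnit_iff.mp hau).1
    have ha2 : IsUnit (H'₁₁ * H₁₁) := (Prod.isUnit_iff.mp hau).2
    have hG₁₁ : IsUnit G₁₁.det := by
      have h := (Matrix.isUnit_iff_isUnit_det _).mp ha1
      rw [Matrix.det_mul] at h
      exact isUnit_of_mul_isUnit_right h
    have hH₁₁ : IsUnit H₁₁.det := by
      have h := (Matrix.isUnit_iff_isUnit_det _).mp ha2
      rw [Matrix.det_mul] at h
      exact isUnit_of_mul_isUnit_right h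
    refine ⟨((Matrix.isUnit_iff_isUnit_det _).mpr hG₁₁).unit,
      (((Matrix.isUnit_iff_isUnit_det _).mpr hH₁₁).unit)⁻¹, ?_⟩
    rw [Matrix.coe_units_inv, IsUnit.unit_spec, IsUnit.unit_spec, ← h11, Matrix.mul_assoc,
      ← Matrix.map_mul, Matrix.mul_nonsing_inv _ hH₁₁, Matrix.map_one C C_0 C_1, Matrix.mul_one]

/-- **`LocalShrinking` holds**: every window-equivariant affine representation of `per_m` can be
replaced by a window-equivariant AND local one of no larger size (corner descent + exchange).
★ Labels: restricted-model lower bound, inside the equivariance barrier; 0 S-currency; closes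
NO item; `DcPerSuperpolynomial` / VP ≠ VNP untouched. -/
theorem localShrinking : LocalShrinking := by
  intro m s A hA
  rcases Nat.eq_zero_or_pos m with hm | hm
  · subst hm
    refine ⟨0, Nat.zero_le _, 0,
      ⟨⟨fun i _ => i.elim0, ?_⟩, fun _ _ => ⟨1, 1, Subsingleton.elim _ _⟩⟩, fun y _ => ⟨0, ?_⟩⟩
    · rw [Matrix.det_isEmpty]
      exact (Matrix.permanent_isEmpty (A := Matrix.mvPolynomialX (Fin 0) (Fin 0) ℂ)).symm
    · rw [map_zero, sub_zero, Subsingleton.elim y 0]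
      exact IsNilpotent.zero
  · haveI : Nonempty (Fin m) := ⟨⟨0, hm⟩⟩
    have hprime : Prime (perPoly (Fin m) ℂ) :=
      UniqueFactorizationMonoid.irreducible_iff_prime.mp perPoly_irreducible
    obtain ⟨hAff, hlifts⟩ := isEquivariantDetRepr_iff_exists_mul_mul.mp hA
    obtain ⟨r, ι, _, _, e, U, V, P, Q, cQ, hrs, hblock, hdegP, hdetP, hlocP, hcQ, hdetQ⟩ :=
      exists_local_corner hprime s A hAff.1 hAff.2
    have hliftsB := lifts_of_block hlifts U V e hblock
    refine ⟨r, hrs, P, isEquivariantDetRepr_iff_exists_mul_mul.mpr ⟨⟨hdegP, hdetP⟩, fun γ hγ => ?_⟩,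
      hlocP⟩
    obtain ⟨G, H, hGH⟩ := hliftsB γ hγ
    exact corner_lift hprime hlocP hdetP hcQ hdetQ γ G H hGH

/-- ★ **Cell A is a theorem**: `EqHardBiPerm` (a `𝔖_m × 𝔖_m`-window-equivariant polynomial-size
family of affine determinantal representations of `per_m` yields a finitely-equivariant one),
by `eqHardBiPerm_of_localShrinking`.  A SUPPORT statement of stmt-ValiantsHypothesis-23702 only.
★ Labels: restricted-model lower bound (necessity side), inside the equivariance barrier;
0 S-currency; closes NO item; `DcPerSuperpolynomial` / VP ≠ VNP untouched; cell A PROVED, so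
piece L ⟺ (A → W) is henceforth EQUIVALENT to W — the W36 dial is exhausted (LESSON 6 terminal
state). -/
theorem eqHardBiPerm : EqHardBiPerm :=
  eqHardBiPerm_of_localShrinking localShrinking

end

end Summit.ValiantsHypothesis.ValiantsHypothesis.Theorems.EquivariantDialLocalShrinking
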